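import Summits.BirchSwinnertonDyer.Rank1Residual.P2.KrizLiJZeroSetting
import Summits.BirchSwinnertonDyer.Rank1Residual.P2.KrizLiSmallCMBase
import HarnessLib

/-!
# Cell `bsd-print-cf2` (D-0131 (2) PRINT TIER, leaf CornerF @ `p = 2`), prover p3 — the generic Kriz–Li door
# CONSUMED on the whole shape `E_a : y² + y = x³ + a` (ty2 g3's `P2.cubicA₃ a`): one by-name slice for every
# globally minimal `E_a` of conductor `< 5000` with a point of infinite order, over ANY Heegner field, (★) DISPLAYED

HONEST FRAMING. The leaf `Summit.BirchSwinnertonDyer.WAllCornerFTwo` and crux `InertJZeroOfFacts` (20671) are OPEN AS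
CLASSES; nothing class-wide is closed; no named fact is introduced; nothing is asserted. ty2 g3's
`P2/KrizLiJZeroSetting.lean` (p556673) proves the `a`-GENERIC Kriz–Li hypotheses of the shape `E_a = [0,0,1,0,a]`
(`E_a(ℚ)[2] = 0` for every `a`, good reduction at `2`, `c₂ = 1`, `j = 0`/CM/`2` inert) and its per-base files supply,
for `a ∈ {−1 (243a1), 600 (1323a1), −2 (1323m1), 92823 (4563a1), 42 (4563b1)}`, global minimality, `N(E_a) < 5000`
and a rational point of infinite order in the kernel. This file is the CONSUMER side, ONCE for all `a`: plugging
those into p3's generic transport (`P2/KrizLiSmallCMBase{Transport,}.lean`, p555698/p556676) gives, granted the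
seven named facts `hKL h33 hS31 hBF hmod hGZK hCassels` (five conjuncts of 𝔅_inert + asides 20767/20768) and a
DISPLAYED (★)-datum `hSD : P2.HasKrizLiStarDatum (cubicA₃ a) K` over an imaginary quadratic `K` with the Heegner
hypothesis: `BSD(W', 2)` for every globally minimal `W'` `ℚ`-isogenous to `E_a^{(d)}` or `E_a^{(d·d_K)}`,
`d ∈ 𝒩(E_a, K)`, `χ_d(−N) = 1`; the analytic ranks along the family; the membership predicate
`IsIsogenousToKrizLiCubicATwistIn a K` and its inclusion in the generic family (aside 21366's road). Currency:
print for `(a, d_K) = (−1, −23)` (Kriz–Li Table 1), LITERAL-by-name((★)-certificate) for the other certified pairs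
(lit g5: 243a1 ×16 fields, 1323a1/1323m1 ×5, 4563a1/4563b1 ×10). The classes of `E_600 = 1323a1 ∼ x³ + y³ = 7²`
and `E_42 = 4563b1 ∼ x³ + y³ = 13` are Sylvester cube-sum classes (p3 `isIsogenous_cubeSumCurve_thirteen`).
Beyond print: NO.

References: [KrizLi2019] Thm 5.1 (2), Thm 4.3, Def 4.1, §6 Ex. 6.2, Table 1, Rem 6.3; [CreutzMiller2012] Thm 1.1;
[BurungaleFlach2024] Thm 1.1, Cor 2; [MilneADT2006] I.7.3; [Cremona1997] Table 1; lit DOSSIER §14.4/§14.6,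
STATUS 2026-08-27T18:37Z (certificates); tree `P2/KrizLiJZeroSetting.lean` (ty2 g3).
-/

noncomputable section

open scoped Classical

open WeierstrassCurve NumberField Literature.NumberTheory.EllipticCurves
  Literature.NumberTheory.EllipticCurves.Rank1Residual
  Literature.NumberTheory.EllipticCurves.ModularForms
  Summit.BirchSwinnertonDyer.Rank1Residual

set_option autoImplicit false

namespace Summit.BirchSwinnertonDyer.Rank1Residual.P2

/-- `N(E_a) ≠ 0` (instance needed by the parametrisation datum at level `N(E_a)`). [folklore] -/
instance neZero_conductorNorm_cubicA₃ (a : ℤ) : NeZero ((cubicA₃ a).conductorNorm ℤ) :=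
  ⟨((cubicA₃ a).conductorNorm_pos_holds).ne'⟩

/-- **`c₂(E_a)` is odd** (it is `1`). [cite: KrizLi2019, Thm. 5.1 hypothesis "c₂(E) odd"] -/
theorem odd_localTamagawaNumber_two_cubicA₃ (a : ℤ) :
    haveI : Fact (2 : ℕ).Prime := ⟨Nat.prime_two⟩
    Odd (((cubicA₃ a).baseChange ℚ_[2]).localTamagawaNumber ℤ_[2]) := by
  rw [localTamagawaNumber_two_cubicA₃]; exact odd_one

section Family

variable (a : ℤ) [(cubicA₃ a).IsGloballyMinimal]

/-- **`ord_{s=1} L(E_a, s) = 1`** for a globally minimal `E_a` with a rational point of infinite order and a (★)-datum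
over a Heegner field `K`. [cite: KrizLi2019, Thm. 4.3 (FMS)] [cite: BurungaleFlach2024, Cor. 2] -/
theorem analyticRank_cubicA₃_of_field (h33 : KrizLi2019.thm33_rank_twist) (hBF : bsdTriple_of_hasCM_of_L_one_ne_zero)
    (hmod : hasEntireLFunction_rat) (hrk : 1 ≤ (cubicA₃ a).mordellWeilRank)
    (K : Type) [Field K] [NumberField K] (hK : IsImaginaryQuadratic K)
    (hH : SatisfiesHeegnerHypothesis ((cubicA₃ a).conductorNorm ℤ) K) (hSD : HasKrizLiStarDatum (cubicA₃ a) K) :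
    (cubicA₃ a).analyticRank = 1 :=
  analyticRank_eq_one_of_hasKrizLiStarDatum (cubicA₃ a) h33 hBF hmod (hasCM_cubicA₃ a) hrk (twoTorsion_cubicA₃ a)
    K hK hH hSD

/-- **THE `a`-GENERIC, `K`-GENERIC SLICE of the shape `y² + y = x³ + a`**: for a globally minimal `E_a` with
`N(E_a) < 5000` and a rational point of infinite order, an imaginary quadratic `K` with the Heegner hypothesis and a
DISPLAYED (★)-datum `hSD`, `d ∈ 𝒩(E_a, K)` with `χ_d(−N) = 1`: every globally minimal `W'` `ℚ`-isogenous to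
`E_a^{(d)}` or `E_a^{(d·d_K)}` satisfies `BSD(W', 2)`, granted the seven named facts.
[cite: KrizLi2019, Thm. 5.1 (2) (FMS, VoR p. 30), Thm. 4.3] [cite: CreutzMiller2012, Thm. 1.1]
[cite: BurungaleFlach2024, Thm. 1.1 and Cor. 2] [cite: MilneADT2006, Thm. I.7.3] -/
theorem bsdp_two_of_isIsogenous_twist_cubicA₃_of_field (hKL : KrizLi2019.thm112_bsdTwo_twist)
    (h33 : KrizLi2019.thm33_rank_twist) (hS31 : bsdTriple_of_analyticRank_le_one_of_conductor_lt)
    (hBF : bsdTriple_of_hasCM_of_L_one_ne_zero) (hmod : hasEntireLFunction_rat)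
    (hGZK : rank_eq_analyticRank_of_analyticRank_le_one) (hCassels : bsdRHS_eq_of_isIsogenous)
    (hN : (cubicA₃ a).conductorNorm ℤ < 5000) (hrk : 1 ≤ (cubicA₃ a).mordellWeilRank)
    (K : Type) [Field K] [NumberField K] (hK : IsImaginaryQuadratic K)
    (hH : SatisfiesHeegnerHypothesis ((cubicA₃ a).conductorNorm ℤ) K) (hSD : HasKrizLiStarDatum (cubicA₃ a) K)
    {d : ℤ} (hd : KrizLi2019.InN (cubicA₃ a) K d)
    (hsign : Int.sign d * jacobiSym ((cubicA₃ a).conductorNorm ℤ) d.natAbs = 1)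
    (W' : WeierstrassCurve ℚ) [W'.IsElliptic] [W'.IsGloballyMinimal]
    (hiso : IsIsogenous W' ((cubicA₃ a).quadraticTwist (d : ℚ)) ∨
      IsIsogenous W' ((cubicA₃ a).quadraticTwist ((d * NumberField.discr K : ℤ) : ℚ))) : BSDp W' 2 :=
  bsdp_two_of_isIsogenous_twist_of_hasKrizLiStarDatum (cubicA₃ a) hKL h33 hS31 hBF hmod hGZK hCassels
    (hasCM_cubicA₃ a) hN hrk (twoTorsion_cubicA₃ a) (odd_localTamagawaNumber_two_cubicA₃ a) K hK hH hSD hd hsign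
    W' hiso

/-- **The analytic ranks along the family of `E_a` over `K`.** [cite: KrizLi2019, Thm. 4.3 (FMS) = arXiv Thm. 3.3] -/
theorem analyticRank_of_twist_cubicA₃_of_field (h33 : KrizLi2019.thm33_rank_twist)
    (hBF : bsdTriple_of_hasCM_of_L_one_ne_zero) (hmod : hasEntireLFunction_rat)
    (hrk : 1 ≤ (cubicA₃ a).mordellWeilRank)
    (K : Type) [Field K] [NumberField K] (hK : IsImaginaryQuadratic K)
    (hH : SatisfiesHeegnerHypothesis ((cubicA₃ a).conductorNorm ℤ) K) (hSD : HasKrizLiStarDatum (cubicA₃ a) K)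
    {d : ℤ} (hd : KrizLi2019.InN (cubicA₃ a) K d)
    (hsign : Int.sign d * jacobiSym ((cubicA₃ a).conductorNorm ℤ) d.natAbs = 1)
    (W₁ W₂ : WeierstrassCurve ℚ) [W₁.IsElliptic] [W₁.IsGloballyMinimal] [W₂.IsElliptic] [W₂.IsGloballyMinimal]
    (hW₁ : ∃ C : VariableChange ℚ, C • (cubicA₃ a).quadraticTwist (d : ℚ) = W₁)
    (hW₂ : ∃ C : VariableChange ℚ, C • (cubicA₃ a).quadraticTwist ((d * NumberField.discr K : ℤ) : ℚ) = W₂) :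
    W₁.analyticRank = 1 ∧ W₂.analyticRank = 0 :=
  analyticRank_of_twist_of_hasKrizLiStarDatum (cubicA₃ a) h33 hBF hmod (hasCM_cubicA₃ a) hrk (twoTorsion_cubicA₃ a)
    K hK hH hSD hd hsign W₁ W₂ hW₁ hW₂

end Family

/-! ## Membership predicate of the `(a, K)`-fibre and the slice in leaf shape -/

/-- **`W'` is `ℚ`-ISOGENOUS to a Kriz–Li twist of `E_a` over the field `K`**: `d ∈ 𝒩(E_a, K)` with `χ_d(−N) = 1` and
`W' ~ E_a^{(d)}` or `W' ~ E_a^{(d·d_K)}`. No (★) inside (display binder); a definition with a body (data `d`).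
[cite: KrizLi2019, Def. 4.1 and Thm. 5.1 (2)] -/
def IsIsogenousToKrizLiCubicATwistIn (a : ℤ) [(cubicA₃ a).IsGloballyMinimal] (K : Type) [Field K] [NumberField K]
    (W' : WeierstrassCurve ℚ) : Prop :=
  ∃ d : ℤ, KrizLi2019.InN (cubicA₃ a) K d ∧ Int.sign d * jacobiSym ((cubicA₃ a).conductorNorm ℤ) d.natAbs = 1 ∧
    (IsIsogenous W' ((cubicA₃ a).quadraticTwist (d : ℚ)) ∨
      IsIsogenous W' ((cubicA₃ a).quadraticTwist ((d * NumberField.discr K : ℤ) : ℚ)))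

/-- **Granted minimality, `N < 5000`, a point of infinite order, the Heegner hypothesis and the (★)-display, the
`(a, K)`-fibre lies in the generic family** `IsIsogenousToKrizLiTwistOfSmallCMBase` (aside 21366's road).
[cite: KrizLi2019, Thm. 5.1 (2) (hypothesis list)] -/
theorem isIsogenousToKrizLiTwistOfSmallCMBase_of_cubicA₃In (a : ℤ) [(cubicA₃ a).IsGloballyMinimal]
    (hN : (cubicA₃ a).conductorNorm ℤ < 5000) (hrk : 1 ≤ (cubicA₃ a).mordellWeilRank)
    (K : Type) [Field K] [NumberField K] (hK : IsImaginaryQuadratic K)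
    (hH : SatisfiesHeegnerHypothesis ((cubicA₃ a).conductorNorm ℤ) K) (hSD : HasKrizLiStarDatum (cubicA₃ a) K)
    {W' : WeierstrassCurve ℚ} (hW' : IsIsogenousToKrizLiCubicATwistIn a K W') :
    IsIsogenousToKrizLiTwistOfSmallCMBase W' := by
  obtain ⟨d, hd, hsign, hiso⟩ := hW'
  exact ⟨cubicA₃ a, inferInstance, inferInstance, inferInstance, hasCM_cubicA₃ a, hN, hrk, twoTorsion_cubicA₃ a,
    odd_localTamagawaNumber_two_cubicA₃ a, K, inferInstance, inferInstance, hK, hH, hSD, d, hd, hsign, hiso⟩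

/-- **Placement** (unconditional): every member has CM with `2` inert in `K_CM` (`j = 0` on the twists; CM and the
CM field are isogeny invariants). [cite: SilvermanAEC2009, Cor. III.9.4 and X.5.4] -/
theorem placement_of_isIsogenousToKrizLiCubicATwistIn (a : ℤ) [(cubicA₃ a).IsGloballyMinimal] (K : Type) [Field K]
    [NumberField K] (W' : WeierstrassCurve ℚ) [W'.IsElliptic] (hW' : IsIsogenousToKrizLiCubicATwistIn a K W') :
    W'.HasCM ∧ CMInert W' 2 := by
  obtain ⟨d, hd, -, hiso⟩ := hW'
  have hD : (NumberField.discr K : ℚ) ≠ 0 := by exact_mod_cast NumberField.discr_ne_zero K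
  have hd0 : (d : ℚ) ≠ 0 := cast_ne_zero_of_inN (cubicA₃ a) hd
  have hd0' : ((d * NumberField.discr K : ℤ) : ℚ) ≠ 0 := by push_cast; exact mul_ne_zero hd0 hD
  have key : ∀ {e : ℚ}, e ≠ 0 → IsIsogenous W' ((cubicA₃ a).quadraticTwist e) → W'.HasCM ∧ CMInert W' 2 := by
    intro e he hiso
    haveI := (cubicA₃ a).isElliptic_quadraticTwist he
    have hT : ((cubicA₃ a).quadraticTwist e).HasCM := hasCM_of_smul_twist_cubicA₃ a he (C := 1) (one_smul _ _)
    have hinT : CMInert ((cubicA₃ a).quadraticTwist e) 2 := cmInert_two_of_smul_twist_cubicA₃ a he (C := 1) (one_smul _ _)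
    have hcmW : W'.HasCM := X12.hasCM_of_isIsogenous hiso.symm_of_charZero hT
    exact ⟨hcmW, (X12.cmInert_iff_of_isIsogenous hiso hcmW 2).2 hinT⟩
  rcases hiso with hiso | hiso
  · exact key hd0 hiso
  · exact key hd0' hiso

/-- **SLICE BY NAME in LEAF SHAPE for the shape `y² + y = x³ + a` over `K`, (★) DISPLAYED.** Currency
LITERAL-by-name((★)-display) off `(a, d_K) = (−1, −23)`. [cite: KrizLi2019, Thm. 5.1 (2), Thm. 4.3]
[cite: CreutzMiller2012, Thm. 1.1] [cite: BurungaleFlach2024, Thm. 1.1 and Cor. 2] [cite: MilneADT2006, Thm. I.7.3] -/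
theorem cornerFTwo_krizLiCubicAIn_byName (hKL : KrizLi2019.thm112_bsdTwo_twist)
    (h33 : KrizLi2019.thm33_rank_twist) (hS31 : bsdTriple_of_analyticRank_le_one_of_conductor_lt)
    (hBF : bsdTriple_of_hasCM_of_L_one_ne_zero) (hmod : hasEntireLFunction_rat)
    (hGZK : rank_eq_analyticRank_of_analyticRank_le_one) (hCassels : bsdRHS_eq_of_isIsogenous)
    (a : ℤ) [(cubicA₃ a).IsGloballyMinimal] (hN : (cubicA₃ a).conductorNorm ℤ < 5000)
    (hrk : 1 ≤ (cubicA₃ a).mordellWeilRank) (K : Type) [Field K] [NumberField K] (hK : IsImaginaryQuadratic K)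
    (hH : SatisfiesHeegnerHypothesis ((cubicA₃ a).conductorNorm ℤ) K) (hSD : HasKrizLiStarDatum (cubicA₃ a) K) :
    ∀ (W : WeierstrassCurve ℚ) [W.IsElliptic] [W.IsGloballyMinimal], W.HasCM → W.analyticRank = 1 →
      CMInert W 2 → IsIsogenousToKrizLiCubicATwistIn a K W → BSDp W 2 :=
  fun W _ _ _ _ _ hW =>
    bsdp_two_of_isIsogenousToKrizLiTwistOfSmallCMBase hKL h33 hS31 hBF hmod hGZK hCassels W
      (isIsogenousToKrizLiTwistOfSmallCMBase_of_cubicA₃In a hN hrk K hK hH hSD hW)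

end Summit.BirchSwinnertonDyer.Rank1Residual.P2

end
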